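import Literature.MathematicalPhysics.QuantumFieldTheory.Balaban1983to89.Node00.SmallFieldChi29OfRecord
import Literature.MathematicalPhysics.QuantumFieldTheory.Balaban1983to89.BlockAveragingPlaquetteBound
import Summits.QuantumFields.BalabanUV.T4Continuum.Support.SubstrateBlockAvgContinuity

/-!
# NODE N09 — THE ONE-DEFECT FIELD UNDER BAŁABAN's (0.4) AVERAGING OF RECORD: `1[b₀(c⋆) ↦ g]` averages to `1[c⋆ ↦ g]` (for `dist1 g ≥ δ`),
# the flat configuration is fixed (`M^k(1) = 1`), and the coarse one-defect field has the far plaquette `g` at `c⋆`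

TRACK A (YM-PLAN §2d, node N09 of 28), seat `pub-ymgap-dag-n09-w2` (D-0149 width seat 2∕4; W-SEAT-START-LIST §n09 item 2), FILE 2a — the generic lattice half of the
JUNK WITNESS against 17H's located (M1) binder `h09inv` (FILE 1 = `…BalabanUVNodesN09LiftInvariance29AtRecord`, p583470; FILE 2b =
`…BalabanUVNodesN09LiftInvariance29JunkWitness` assembles the witness at the record).  Key of record: K1⁷ `StabilityBAtRecordR13SepCoPH` = stmt-QuantumFields-20542;
`--supports` it as a helper (Summits lane).  [I] = [Balaban1987RG1] (CMP 109), [B7] = [Balaban1985Averaging] (CMP 98).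

CONTENT (kernel bookkeeping over the tree's (0.4) block averaging `BlockAveraging.avgFun ℰ` and pub-balaban's `BlockAveragingHaarAC` normal form
`pre ∕ post ∕ openHol ∕ IsCentral ∕ centralBond` — all BY NAME; `centralBond c = b₀(c)`, the crossing bond on the axis of `c`):
* §1 THE FLAT CONFIGURATION IS FIXED — BY NAME from ne7's substrate (`SubstrateBackgroundDriven.holAt_one_cfg ∕ loopHol_one_cfg ∕ axialAvg_one_cfg ∕
  small_one_cfg ∕ iter_one`, `SubstrateBlockAvgContinuity.ESU_const_one ∕ blockAvg_expMeanLogSU_one`): the open holonomies ∕ `pre` ∕ `post` of `1` are `1`,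
  `ℰ.avg` of a constant-`1` family is `1` for the printed `exp[mean log]`, `avOfRecord_avg_one`; `M^k(1) = 1` — FILE 1's junk-corner reference
  configuration IS the unit configuration — is dag-n07-e's `BalabanUVNodesN07Prop8StepFlatWitness.iter_avOfRecord_one` (not restated).
* §2 THE ONE-DEFECT FIELD `Function.update 1 (centralBond c⋆) g`: `U(c⋆) = g`, `U(c′) = 1` and all loop variables `1` at `c′ ≠ c⋆` (`loopHol_update_centralBond`);
  at `c⋆` a NON-central loop variable is `g⁻¹` (`openHol_update_of_not_isCentral`), so for `dist1 g ≥ ℰ.δ` the guard `Small` FAILS and (0.4) falls back to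
  the axial transporter: ★ `avgFun expMeanLogSU (1[b₀(c⋆) ↦ g]) = 1[c⋆ ↦ g]` (`avgFun_expMeanLogSU_update_one`).
* §3 the coarse one-defect field has the plaquette `g` at `⟨c⋆₋; c⋆.dir, ν⟩` (`plaqHol_update_one`; `x + e_ν ≠ x` on every torus of `Params`), so it is NOT
  `δ`-small for `δ ≤ dist1 g`.

HONEST FRAMING: lattice∕group bookkeeping only; nothing of Bałaban's asserted; N09 NOT discharged; K0⁷ ∕ K1⁷ OPEN; counts unmoved (typed 28∕28 · discharged 5∕27);
R4 is the conditional finite-𝕋⁴ rung `BalabanLadder.UV` only — NOT continuum ∕ ℝ⁴ ∕ OS ∕ mass gap ∕ Clay.  THEOREMS ONLY (0 `def`, 0 `sorry`), standard axioms.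
-/

noncomputable section

namespace Summit.QuantumFields.YangMills.BalabanUVNodes.N09OneDefectAveraging

open Literature.MathematicalPhysics.QuantumFieldTheory.Balaban1983to89
open Literature.MathematicalPhysics.QuantumFieldTheory.Balaban1983to89.Node00
open scoped Matrix.Norms.L2Operator
open T4Continuum (holAt holAt_nil holAt_cons walk LStep axialAvg_eq_holAt_walk)
open AveragingRT (axialAvg)
open BlockAveraging (Idx off loopHol Small corr avgFun blockAvg)
open BlockAveragingHaarAC (centralBond IsCentral openHol pre post loopHol_eq_openHol_mul openHol_of_isCentral openHol_update_of_not_isCentral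
  axialAvg_update_centralBond axialAvg_update_centralBond_of_ne loopHol_update_centralBond avgFun_of_not_small)
open ExpMeanLog (expMeanLogSU deltaSU deltaSU_pos)
open GaugeField (plaqHol)
open Summit.QuantumFields.BalabanUV.T4Continuum.SubstrateBackgroundDriven (holAt_one_cfg loopHol_one_cfg axialAvg_one_cfg small_one_cfg)
open Summit.QuantumFields.BalabanUV.T4Continuum.SubstrateBlockAvgContinuity (blockAvg_expMeanLogSU_one)


/-! ## §1. The flat configuration is fixed by the averaging of record -/

section Flat

variable {P : Params} {j : ℕ} {G : Type*} [GaugeGroup G]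

/-- The straight transporter of the unit configuration is `1` at every coarse bond (ne7's `axialAvg_one_cfg`, pointwise). [cite: Balaban1984PropagatorsI, (1.7) p.18 (bookkeeping)] -/
theorem axialAvg_one (c : PBond P (j + 1)) : axialAvg (1 : GaugeField P j G) c = 1 :=
  congrFun axialAvg_one_cfg c

/-- Every (0.4) loop-variable FAMILY of the unit configuration is the constant-`1` family (ne7's `loopHol_one_cfg`, as a function). [cite: Balaban1987RG1, (0.4) p.253 (bookkeeping)] -/
theorem loopHol_one (c : PBond P (j + 1)) : loopHol (1 : GaugeField P j G) c = fun _ => 1 :=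
  funext (loopHol_one_cfg c)

/-- Every open (0.4) holonomy of the unit configuration is `1`. [cite: Balaban1987RG1, (0.4) p.253 (bookkeeping)] -/
theorem openHol_one (c : PBond P (j + 1)) (i : Idx P) : openHol (1 : GaugeField P j G) c i = 1 := holAt_one_cfg _

/-- `pre 1 c = 1`. [cite: Balaban1987RG1, (0.4) p.253 (bookkeeping)] -/
theorem pre_one (c : PBond P (j + 1)) : pre (1 : GaugeField P j G) c = 1 := holAt_one_cfg _

/-- `post 1 c = 1`. [cite: Balaban1987RG1, (0.4) p.253 (bookkeeping)] -/
theorem post_one (c : PBond P (j + 1)) : post (1 : GaugeField P j G) c = 1 := holAt_one_cfg _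

/-- `avgFun ℰ 1 c = ℰ{1, …, 1}` (the average of the constant-`1` family of loop variables). [cite: Balaban1987RG1, (0.4) p.253 (bookkeeping)] -/
theorem avgFun_one_apply (ℰ : LoopAverage G) (c : PBond P (j + 1)) : avgFun ℰ (1 : GaugeField P j G) c = ℰ.avg (fun _ : Idx P => (1 : G)) := by
  show corr ℰ 1 c * axialAvg 1 c = _
  unfold corr
  rw [if_pos (small_one_cfg ℰ c), axialAvg_one, mul_one, loopHol_one]

end Flat

section FlatSU

variable {n : Type*} [Fintype n] [DecidableEq n] [Nonempty n]

/-- In the unitary model `dist1 U ≤ 0` forces `U = 1` (`dist1 U = ‖U − 1‖`). [folklore] -/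
theorem eq_one_of_dist1_le_zero {U : Matrix.specialUnitaryGroup n ℂ} (h : dist1 U ≤ 0) : U = 1 := by
  have h0 : ‖(U : Matrix n n ℂ) - 1‖ = 0 := le_antisymm h (norm_nonneg _)
  exact Subtype.ext (sub_eq_zero.1 (norm_eq_zero.1 h0))

/-- The printed `exp[mean log]` `LoopAverage.avg` of a constant-`1` family (any finite index type) is `1` (ym3's `dist1_expMeanLogSU_avg_le` at `t = 0`;
ne7's `ESU_const_one` is the `Fin`-family form). [cite: Balaban1987RG1, (0.4) p.253 (bookkeeping)] -/
theorem expMeanLogSU_avg_const_one {ι : Type*} [Fintype ι] [Nonempty ι] : (expMeanLogSU (n := n)).avg (fun _ : ι => (1 : Matrix.specialUnitaryGroup n ℂ)) = 1 := by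
  refine eq_one_of_dist1_le_zero ?_
  have h := BlockAveragingPlaquetteBound.dist1_expMeanLogSU_avg_le (W := fun _ : ι => (1 : Matrix.specialUnitaryGroup n ℂ)) (t := 0)
    (fun _ => by rw [GaugeGroup.dist1_one]) deltaSU_pos
  simpa using h

end FlatSU

variable {F : T4Continuum.T4Family} {N : ℕ} [NeZero N]

/-- The averaging of record fixes the unit configuration (ne7's `blockAvg_expMeanLogSU_one` at the record's name). [cite: Balaban1987RG1, (0.4) p.253 (bookkeeping)] -/
theorem avOfRecord_avg_one (K j : ℕ) : (avOfRecord F N K j).avg (1 : GaugeField (F.P K) j (SU N)) = 1 :=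
  blockAvg_expMeanLogSU_one (F.P K) j

/-! ## §2. The one-defect field `1[b₀(c⋆) ↦ g]` and its (0.4) average -/

section Defect

variable {P : Params} {j : ℕ} {G : Type*} [GaugeGroup G]

/-- `U(c⋆) = g` for the one-defect field (`U(c) = pre · U(b₀(c)) · post`). [cite: Balaban1987RG1, (0.4) p.253 (bookkeeping)] -/
theorem axialAvg_update_one_self (hj : j + 1 ≤ P.m + P.K) (c : PBond P (j + 1)) (g : G) :
    axialAvg (Function.update (1 : GaugeField P j G) (centralBond c) g) c = g := by
  rw [axialAvg_update_centralBond hj, pre_one, post_one, one_mul, mul_one]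

/-- `U(c′) = 1` at every other coarse bond. [cite: Balaban1987RG1, (0.4) p.253 (bookkeeping)] -/
theorem axialAvg_update_one_of_ne (hj : j + 1 ≤ P.m + P.K) {c c' : PBond P (j + 1)} (hc : c' ≠ c) (g : G) :
    axialAvg (Function.update (1 : GaugeField P j G) (centralBond c) g) c' = 1 := by
  rw [axialAvg_update_centralBond_of_ne hj _ _ _ hc, axialAvg_one]

/-- Every loop variable at `c′ ≠ c⋆` is `1` (no loop of `c′` passes through `b₀(c⋆)`, pub-balaban's `loopHol_update_centralBond`).
[cite: Balaban1987RG1, (0.4) p.253 (bookkeeping)] -/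
theorem loopHol_update_one_of_ne (hj : j + 1 ≤ P.m + P.K) {c c' : PBond P (j + 1)} (hc : c' ≠ c) (g : G) :
    loopHol (Function.update (1 : GaugeField P j G) (centralBond c) g) c' = fun _ => 1 := by
  rw [loopHol_update_centralBond hj _ _ _ hc, loopHol_one]

/-- … so `Ū(c′) = ℰ{1, …, 1}` there. [cite: Balaban1987RG1, (0.4) p.253 (bookkeeping)] -/
theorem avgFun_update_one_of_ne (hj : j + 1 ≤ P.m + P.K) (ℰ : LoopAverage G) {c c' : PBond P (j + 1)} (hc : c' ≠ c) (g : G) :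
    avgFun ℰ (Function.update (1 : GaugeField P j G) (centralBond c) g) c' = ℰ.avg (fun _ : Idx P => (1 : G)) := by
  have hS : Small ℰ (Function.update (1 : GaugeField P j G) (centralBond c) g) c' := by
    intro i
    rw [loopHol_update_one_of_ne hj hc]
    simp only [GaugeGroup.dist1_one]
    exact ℰ.δ_pos
  show corr ℰ _ c' * axialAvg _ c' = _
  unfold corr
  rw [if_pos hS, axialAvg_update_one_of_ne hj hc, mul_one, loopHol_update_one_of_ne hj hc]

/-- At `c⋆` the loop variable of a NON-central index is `g⁻¹` (the open holonomy does not see `b₀(c⋆)`, the closing segment `(−c⋆)` does).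
[cite: Balaban1987RG1, (0.4) p.253 (bookkeeping)] -/
theorem loopHol_update_one_self_of_not_isCentral (hj : j + 1 ≤ P.m + P.K) (c : PBond P (j + 1)) (g : G) {i : Idx P}
    (hi : ¬ IsCentral c i) : loopHol (Function.update (1 : GaugeField P j G) (centralBond c) g) c i = g⁻¹ := by
  rw [loopHol_eq_openHol_mul, openHol_update_of_not_isCentral hj _ _ _ hi, openHol_one, one_mul, axialAvg_update_one_self hj c g]

/-- A non-central index exists at every coarse bond as soon as `d ≥ 2` (transverse offset `−(L−1)/2 ≠ 0`, `L ≥ 3`). [cite: Balaban1987RG1, (0.3) p.252 (bookkeeping)] -/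
theorem exists_not_isCentral (hd : 2 ≤ P.d) (c : PBond P (j + 1)) : ∃ i : Idx P, ¬ IsCentral c i := by
  have hL := P.hL.2
  obtain ⟨k, hk⟩ := P.hL.1
  obtain ⟨ν, hν⟩ : ∃ ν : Fin P.d, ν ≠ c.dir := by
    by_cases h0 : c.dir = ⟨0, by omega⟩
    · exact ⟨⟨1, by omega⟩, fun h => by rw [h0] at h; simp [Fin.ext_iff] at h⟩
    · exact ⟨⟨0, by omega⟩, fun h => h0 h.symm⟩
  refine ⟨(fun _ => ⟨0, P.L_pos⟩, 1, 1), fun h => ?_⟩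
  have h1 := h ν hν
  simp only [off] at h1
  omega

/-- For `dist1 g ≥ δ` the guard `Small` FAILS at `c⋆` for the one-defect field. [cite: Balaban1987RG1, (0.4) p.253 (bookkeeping)] -/
theorem not_small_update_one (hj : j + 1 ≤ P.m + P.K) (hd : 2 ≤ P.d) (ℰ : LoopAverage G) (c : PBond P (j + 1)) {g : G} (hg : ℰ.δ ≤ dist1 g) :
    ¬ Small ℰ (Function.update (1 : GaugeField P j G) (centralBond c) g) c := by
  obtain ⟨i, hi⟩ := exists_not_isCentral hd c
  intro hS
  have h := hS i
  rw [loopHol_update_one_self_of_not_isCentral hj c g hi, GaugeGroup.dist1_inv] at h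
  exact absurd h (not_lt.2 hg)

/-- … so `Ū(c⋆) = U(c⋆) = g` (fallback to the axial transporter). [cite: Balaban1987RG1, (0.4) p.253 (bookkeeping)] -/
theorem avgFun_update_one_self (hj : j + 1 ≤ P.m + P.K) (hd : 2 ≤ P.d) (ℰ : LoopAverage G) (c : PBond P (j + 1)) {g : G} (hg : ℰ.δ ≤ dist1 g) :
    avgFun ℰ (Function.update (1 : GaugeField P j G) (centralBond c) g) c = g := by
  rw [avgFun_of_not_small ℰ _ c (not_small_update_one hj hd ℰ c hg), axialAvg_update_one_self hj c g]

end Defect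

/-- **★ THE ONE-DEFECT FIELD AVERAGES TO THE ONE-DEFECT COARSE FIELD** under the (0.4) averaging with the printed inner operation: for `dist1 g ≥ δ_N`,
`avgFun expMeanLogSU (1[b₀(c⋆) ↦ g]) = 1[c⋆ ↦ g]`. [cite: Balaban1987RG1, (0.4) p.253 (bookkeeping)] -/
theorem avgFun_expMeanLogSU_update_one {n : Type*} [Fintype n] [DecidableEq n] [Nonempty n] {P : Params} {j : ℕ} (hj : j + 1 ≤ P.m + P.K) (hd : 2 ≤ P.d)
    (c : PBond P (j + 1)) {g : Matrix.specialUnitaryGroup n ℂ} (hg : deltaSU n ≤ dist1 g) :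
    avgFun expMeanLogSU (Function.update (1 : GaugeField P j (Matrix.specialUnitaryGroup n ℂ)) (centralBond c) g) =
      Function.update (1 : GaugeField P (j + 1) (Matrix.specialUnitaryGroup n ℂ)) c g := by
  funext c'
  by_cases hc : c' = c
  · subst hc
    rw [Function.update_self]
    exact avgFun_update_one_self hj hd _ c' hg
  · rw [Function.update_of_ne hc, avgFun_update_one_of_ne hj _ hc, expMeanLogSU_avg_const_one]
    rfl

/-! ## §3. The far plaquette of the coarse one-defect field -/

section Plaquette

variable {P : Params} {j : ℕ} {G : Type*} [GaugeGroup G]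

/-- `x + e_ν ≠ x` on every torus of `Params` (`|T^{(j)}| = 2·L^e ≥ 2` per direction). [cite: Balaban1987RG1, (0.1) p.251 (bookkeeping)] -/
theorem shift_ne_self (x : Site P j) (ν : Fin P.d) : x.shift ν ≠ x := by
  intro h
  have h1 := congrFun h ν
  simp only [Site.shift, Function.update_self] at h1
  have hlt : 1 < P.sitesPerDir j := by
    unfold Params.sitesPerDir
    have : 1 ≤ P.L ^ (P.m + P.K - j) := Nat.one_le_pow _ _ P.L_pos
    omega
  haveI : Fact (1 < P.sitesPerDir j) := ⟨hlt⟩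
  exact one_ne_zero (add_eq_left.1 h1)

/-- **The plaquette of the coarse one-defect field at `⟨c⋆₋; c⋆.dir, ν⟩` is `g`.** [cite: Balaban1985Averaging, (9) p.19 (bookkeeping)] -/
theorem plaqHol_update_one (c : PBond P j) {ν : Fin P.d} (hν : c.dir < ν) (g : G) :
    plaqHol (Function.update (1 : GaugeField P j G) c g) ⟨c.src, c.dir, ν, hν⟩ = g := by
  have hne : c.dir ≠ ν := ne_of_lt hν
  have h2 : (⟨c.src.shift c.dir, ν⟩ : PBond P j) ≠ c := fun h => hne (by rw [← h])
  have h3 : (⟨c.src.shift ν, c.dir⟩ : PBond P j) ≠ c := fun h => shift_ne_self c.src ν (by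
    have := congrArg PBond.src h; exact this)
  have h4 : (⟨c.src, ν⟩ : PBond P j) ≠ c := fun h => hne (by rw [← h])
  show Function.update (1 : GaugeField P j G) c g ⟨c.src, c.dir⟩ * Function.update (1 : GaugeField P j G) c g ⟨c.src.shift c.dir, ν⟩ *
      (Function.update (1 : GaugeField P j G) c g ⟨c.src.shift ν, c.dir⟩)⁻¹ * (Function.update (1 : GaugeField P j G) c g ⟨c.src, ν⟩)⁻¹ = g
  rw [Function.update_of_ne h2, Function.update_of_ne h3, Function.update_of_ne h4,
    show (⟨c.src, c.dir⟩ : PBond P j) = c from rfl, Function.update_self]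
  show g * 1 * (1 : G)⁻¹ * (1 : G)⁻¹ = g
  simp

/-- … so the coarse one-defect field is NOT `δ`-small for `δ ≤ dist1 g` (needs a direction `ν > c⋆.dir`). [cite: Balaban1987RG1, (0.18) p.255 (bookkeeping)] -/
theorem not_plaqSmall_update_one (c : PBond P j) {ν : Fin P.d} (hν : c.dir < ν) {g : G} {δ : ℝ} (hδ : δ ≤ dist1 g) :
    ¬ PlaqSmall δ (Function.update (1 : GaugeField P j G) c g) := fun h => by
  have h1 := h ⟨c.src, c.dir, ν, hν⟩
  rw [plaqHol_update_one c hν g] at h1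
  exact absurd h1 (not_lt.2 hδ)

end Plaquette

end Summit.QuantumFields.YangMills.BalabanUVNodes.N09OneDefectAveraging
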